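import Summits.QuantumFields.YangMills.Theorems.UnitScaleTiltEXGuardedFiveOutright
import HarnessLib

/-!
# Route `UnitScaleTilt`, crux K1 «MinimiserStabilityRegPr» (stmt-QuantumFields-19200) — **THE RESIDUE BY KERNEL: THE REGISTERED CRUX IS EQUIVALENT TO ITS OWN
# BLOCK-SIZE-3 INSTANCE, and it follows from the EX body at L = 3 alone** (chair ★p1 g30; THEOREMS ONLY — 0 `def`, 0 `sorry`, 0 `instance`;
# `--supports stmt-QuantumFields-19200 --as helper`; registry ∕ route ∕ `closes` untouched — J-FREEZE to 2026-09-02 honoured)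

Cell `ym3-torus` (HUMAN RULING D-0037; rung R3 = SU(2) YM₃ on T³ — NOT d = 4, NOT infinite volume, NOT a mass gap, NOT Clay).

WHY.  `T3Family.hL : Odd L ∧ 1 < L`, so a `T3Family` member exists only at odd block sizes `L ≥ 3`; the crux text `∀ L, ∃ ε₁ …, ∀ F γ, F.L = L → …` is therefore
VACUOUS at every `L` that is even or `≤ 1`, and for every `L ≥ 5` its body is the OUTRIGHT tree theorem ✓`EXGuardedFiveOutright.minimiserStabilityRegPr_guarded_five`
(px16 g16 ✓p790882 over the guarded EX chain Sᵍ, RULING №55, and ★p1 g29 ✓`MinimiserStabilityRegPrGuarded.minimiserStabilityRegPr_guarded_of_existence5`).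
Hence the registered crux — as filed, with NO edit — is LOGICALLY EQUIVALENT to its single instance `L = 3` (§3).  §2 is the skeleton's composition
`MinimiserStabilityRegPr_of` read AT ONE BLOCK SIZE: ⟨crux body at L⟩ ⟸ ⟨EX body at L⟩ (H = ✓`stub_halvingStep` by name) — the per-`L` form of
✓`AttainmentOfExistence.MinimiserStabilityRegPr_of_halvingStep_of_existence` and of ✓`minimiserStabilityRegPr_guarded_of_existence5`; with §3 it gives
⟨crux BY NAME⟩ ⟸ ⟨EX body at L = 3 ALONE⟩ (§4).  (EX-side companion, same evening: ym-line-cst-p1 g39 `Thm1GuardedFiveResidueThree.exBody_allL_of_three` —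
the registered EX text ⟸ its L = 3 instance; not imported here, to keep this file's cone at ✓`EXGuardedFiveOutright`.)

WHAT THIS IS FOR (post-freeze docket (5)(ii), ★★OWNER g39 § FINAL; px21 g17 LOCATE-L3, 19200 evidence #49∕#51).  The located residue LF-1EX is the L = 3 class:
lit-balaban's [Balaban1985RegularSpaces]-Thm-2 cover chain is typed over `B6KLevelCensusIndexV1.KIdx.hℓ : 4 ≤ ℓ` (L = ℓ + 1 ≥ 5) with one genuine geometric
reader ([Balaban1985BackgroundPropagators] Cor. 3.6 hull, `2ℓS ≥ 5S + 1`), and print runs the full programme for «L an odd positive integer > 11»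
([Balaban1987RG1] §0 p.251).  This file states exactly what a re-cut `5 ≤ L →` removes (the conjunct `⟨body at 3⟩`, nothing else) and exactly what an
L = 3 supplier must deliver (`⟨EX body at 3⟩`, §4) — by kernel, not by prose.

WHAT IS PROVED (namespace `Summit.QuantumFields.YangMills.Theorems.MinimiserStabilityRegPrResidueThree`).
* §1 `blockSize_trichotomy` (`¬(Odd L ∧ 1 < L) ∨ L = 3 ∨ 5 ≤ L`), `not_blockSize_of_not_admissible`, `cruxBody_of_not_admissible` (vacuity off the admissible block sizes).
* §2 ★★ `cruxBody_of_exBody (L) (1 < L)` — ⟨crux body at L⟩ ⟸ ⟨EX body at L⟩, ONE block size at a time (composition of record, H by name).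
* §3 ★★★ `minimiserStabilityRegPr_of_three`, ★★★ `minimiserStabilityRegPr_iff_three : MinimiserStabilityRegPr ↔ ⟨its body at L = 3⟩`.
* §4 ★★★ `minimiserStabilityRegPr_of_exBody_three : ⟨EX body at L = 3⟩ → MinimiserStabilityRegPr` (§2 at L = 3 ∘ §3).
HONEST SCOPE.  Logic over landed theorems; NOTHING at L = 3 is proved; the crux 19200, EX, the leaf `YM3TorusSU2`, rung R3 are NOT proved; §3–§4 are EQUIVALENCES ∕
CONDITIONALS and credit nothing.  Rung R3 = SU(2) YM₃ on T³ — NOT d = 4, NOT infinite volume, NOT a mass gap, NOT Clay; the Yang–Mills mass gap is NOT proved.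
References: T. Bałaban, CMP **102** (1985) 277–309 [Balaban1985Variational] (Thm 1 (6)–(10) pp.278–279, Prop. 7 p.299, Prop. 8 p.304); CMP **99** (1985) 75–102
[Balaban1985RegularSpaces] (Thm 2 p.83); CMP **99** (1985) 389–434 [Balaban1985BackgroundPropagators] (Cor. 3.6 p.408); CMP **109** (1987) 249–301 [Balaban1987RG1] (§0 p.251);
CMP **102** (1985) 255–275 [Balaban1985UV3] ((1)–(3) p.256).
-/

set_option autoImplicit false

noncomputable section

namespace Summit.QuantumFields.YangMills.Theorems.MinimiserStabilityRegPrResidueThree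

open MeasureTheory Filter Topology
open scoped Matrix.Norms.L2Operator
open Literature.MathematicalPhysics.QuantumFieldTheory.Balaban1983to89
open Literature.MathematicalPhysics.QuantumFieldTheory.Balaban1983to89.T3ContinuumYM3Torus
open Literature.MathematicalPhysics.QuantumFieldTheory.Balaban1983to89.T3UnitLawDensityEML (ℰp measurableE_ℰp)
open Literature.MathematicalPhysics.QuantumFieldTheory.Balaban1983to89.T3UnitScaleTilt
open Literature.MathematicalPhysics.QuantumFieldTheory.Balaban1983to89.T3TiltDescent
open Literature.MathematicalPhysics.QuantumFieldTheory.Balaban1983to89.T3CruxEstimates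
open Literature.MathematicalPhysics.QuantumFieldTheory.Balaban1983to89.T3ConstrainedMinimiser
open Literature.MathematicalPhysics.QuantumFieldTheory.Balaban1983to89.T3DescentFibreTower
open Literature.MathematicalPhysics.QuantumFieldTheory.Balaban1983to89.T3MinimiserStabilityReduction
open Literature.MathematicalPhysics.QuantumFieldTheory.Balaban1983to89.T3RegularMinimiser
open Literature.MathematicalPhysics.QuantumFieldTheory.Balaban1983to89.T3PrintedRegularMinimiser
open Literature.MathematicalPhysics.QuantumFieldTheory.Balaban1983to89.T3PrintedRegularMinimiserReduction
open Literature.MathematicalPhysics.QuantumFieldTheory.Balaban1983to89.T3PrintedMinimiserExistence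
open Literature.MathematicalPhysics.QuantumFieldTheory.Balaban1983to89.T3LowerAlongMinimisersSplit
open Literature.MathematicalPhysics.QuantumFieldTheory.Balaban1983to89.T3AvgDivergenceSplit
open Literature.MathematicalPhysics.QuantumFieldTheory.Balaban1983to89.T3UpperAlongMinimisersSplit
open Literature.MathematicalPhysics.QuantumFieldTheory.Balaban1983to89.T3UpperLiftSplit
open Literature.MathematicalPhysics.QuantumFieldTheory.Balaban1983to89.T3LowerActionSplit
open Literature.MathematicalPhysics.QuantumFieldTheory.Balaban1983to89.T3ExistSplit
open Literature.MathematicalPhysics.QuantumFieldTheory.Balaban1983to89.T3Thm1Carrier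
open Literature.MathematicalPhysics.QuantumFieldTheory.Balaban1983to89.T3CurvGradLog
open Literature.MathematicalPhysics.QuantumFieldTheory.Balaban1983to89.T3SplitLog
open Literature.MathematicalPhysics.QuantumFieldTheory.Balaban1983to89.T3UpperLiftSplitLog
open Literature.MathematicalPhysics.QuantumFieldTheory.Balaban1983to89.B11 (Prop8Printed)
open Summit.QuantumFields.YangMills.Theorems.AttainmentOfExistence (minSixAttainedAt_of_existence_prop8)
open Summit.QuantumFields.YangMills.Theorems.MinimiserStabilityRegPrStubHalvingStep (stub_halvingStep)
open Summit.QuantumFields.YangMills.Theorems.EXGuardedFiveOutright (exBody_guarded_five minimiserStabilityRegPr_guarded_five)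

/-! ## §1 Block-size trichotomy and vacuity off the admissible block sizes -/

/-- A block size is either inadmissible for `T3Family` (`¬(Odd L ∧ 1 < L)`), or `3`, or at least `5`. [folklore] -/
theorem blockSize_trichotomy (L : ℕ) : ¬ (Odd L ∧ 1 < L) ∨ L = 3 ∨ 5 ≤ L := by
  by_cases h : Odd L ∧ 1 < L
  · obtain ⟨⟨k, hk⟩, h1⟩ := h
    right; omega
  · exact Or.inl h

/-- No `T3Family` member has an inadmissible block size (`T3Family.hL : Odd L ∧ 1 < L`). [cite: Balaban1985UV3, (1)-(3) p.256] -/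
theorem not_blockSize_of_not_admissible {L : ℕ} (h : ¬ (Odd L ∧ 1 < L)) (F : T3Family) : F.L ≠ L :=
  fun hF => h (hF ▸ F.hL)

/-- **VACUITY OF THE CRUX BODY off the admissible block sizes**: if `¬(Odd L ∧ 1 < L)` the crux's body at `L` holds with `ε₁ = 1`, `m₀ = 0`, `γ₁ = 1`
(no family has `F.L = L`). [cite: Balaban1985UV3, (1)-(3) p.256] -/
theorem cruxBody_of_not_admissible (L : ℕ) (h : ¬ (Odd L ∧ 1 < L)) :
    ∃ ε₁ : ℝ, 0 < ε₁ ∧ ∀ (ε₀ : ℝ), 0 < ε₀ → ε₀ ≤ ε₁ → ∃ m₀ : ℕ, ∀ (m : ℕ), m₀ ≤ m →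
      ∀ (b₀ p₀ : ℝ), 0 < b₀ → 2 < p₀ → ∃ γ₁ : ℝ, 0 < γ₁ ∧ ∀ (F : T3Family) (γ : ℝ), F.L = L → 0 < γ → γ ≤ γ₁ →
        MinimiserStabilityRegPrAt F γ b₀ p₀ m ε₀ :=
  ⟨1, one_pos, fun _ _ _ => ⟨0, fun _ _ _ _ _ _ => ⟨1, one_pos, fun F _ hFL _ _ => absurd hFL (not_blockSize_of_not_admissible h F)⟩⟩⟩

/-! ## §2 The composition of record, ONE block size at a time: ⟨crux body at L⟩ ⟸ ⟨EX body at L⟩ -/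

/-- ★★ **⟨`MinimiserStabilityRegPr` body at `L`⟩ ⟸ ⟨EX body at `L`⟩, for ONE block size `L > 1`** — the skeleton birth_v10 composition
`MinimiserStabilityRegPr_of` (and ✓`minimiserStabilityRegPr_guarded_of_existence5`) read at a single `L`: Prop. 8 from ✓`stub_halvingStep`
(✓`Prop8Iter.prop8_of_halvingLiteral`), attainment over (6) from the EX clause AT THIS `L` (✓`minSixAttainedAt_of_existence_prop8`), minimisers in (8)
(✓`minimisersIn8At_of_prop8`), the log-Lipschitz curvature gradient (✓`CritCurvGradLog.stub_critCurvGradLog`, ✓`minimiserCurvGradLogAt_of_crit`); EXIST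
(`hasRegMinimisersPrAt_of_attained`) ∕ UPPER (`upperAlongRegPrMinimisersAt_of_splitLog'` with ✓`SmoothLift.stub_smoothLift`) ∕ LOWER
(`lowerAlongRegPrMinimisersAt_of_splitLog'''` with ✓`AvgCurvGrad.stub_avgCurvGrad`, ✓`AvgActionDefect.stub_avgActionDefect`), then
`minimiserStabilityRegPrAt_of_alongRegPrMinimisers`; `ε₁ := min` of three, `m₀ := 10`, `γ₁ := min` of three.  CONDITIONAL on `hEX`.
[cite: Balaban1985Variational, Thm 1 (6)-(10) pp.278-279, Prop. 7 p.299, Prop. 8 p.304] -/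
theorem cruxBody_of_exBody (L : ℕ) (hL : 1 < L)
    (hEX : ∀ (B₃ : ℝ), 4 < B₃ → ∃ a₁' O₁ : ℝ, 0 < a₁' ∧ 1 ≤ O₁ ∧
      ∀ (F : T3Family), F.L = L → ∀ (n K : ℕ) (hnK : n < K) (ε₁ : ℝ), 0 < ε₁ →
        ∀ V : GaugeField (F.P n) 0 (Matrix.specialUnitaryGroup (Fin 2) ℂ), PlaqSmall ε₁ V →
          ∀ U₀ : GaugeField (F.P K) 0 (Matrix.specialUnitaryGroup (Fin 2) ℂ), RegPr F n K ((L : ℝ) ^ 3 * B₃ * ε₁) U₀ → U₀ ∈ fibre F ℰp n K hnK.le V →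
            ε₁ ≤ a₁' → ∃ U ∈ regFibrePr F n K hnK.le (O₁ * (L : ℝ) ^ 3 * B₃ * ε₁) V,
              IsMinOn (fun W : GaugeField (F.P K) 0 (Matrix.specialUnitaryGroup (Fin 2) ℂ) => wilsonAction4 W)
                (regFibrePr F n K hnK.le (O₁ * (L : ℝ) ^ 3 * B₃ * ε₁) V) U) :
    ∃ ε₁ : ℝ, 0 < ε₁ ∧ ∀ (ε₀ : ℝ), 0 < ε₀ → ε₀ ≤ ε₁ → ∃ m₀ : ℕ, ∀ (m : ℕ), m₀ ≤ m →
      ∀ (b₀ p₀ : ℝ), 0 < b₀ → 2 < p₀ → ∃ γ₁ : ℝ, 0 < γ₁ ∧ ∀ (F : T3Family) (γ : ℝ), F.L = L → 0 < γ → γ ≤ γ₁ →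
        MinimiserStabilityRegPrAt F γ b₀ p₀ m ε₀ := by
  -- Prop. 8 from the halving step; attainment over (6) from the existence clause at this `L`; minimisers in (8); the curvature gradient
  obtain ⟨B₃, hB₃, h8⟩ := Summit.QuantumFields.YangMills.Theorems.Prop8Iter.prop8_of_halvingLiteral stub_halvingStep L hL
  have hB₃0 : 0 < B₃ := by linarith
  obtain ⟨â₀, â₁, hâ₀, hâ₁, hatt⟩ := minSixAttainedAt_of_existence_prop8 hL hB₃ (hEX B₃ hB₃) h8
  obtain ⟨a₀, ha₀, h8'⟩ := minimisersIn8At_of_prop8 hB₃0 h8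
  obtain ⟨a₁, B₄, ha₁, hB₄, hc⟩ := Summit.QuantumFields.YangMills.Theorems.CritCurvGradLog.stub_critCurvGradLog L hL B₃ hB₃
  have hIn8 : MinimisersIn8At L a₀ a₁ B₃ := h8' a₁
  have hgrad : MinimiserCurvGradLogAt L a₀ a₁ B₃ B₄ := minimiserCurvGradLogAt_of_crit hB₃0 hc (h8' a₁)
  -- EXIST
  obtain ⟨e₁, he₁, hE⟩ := hasRegMinimisersPrAt_of_attained hâ₀ hâ₁ hB₃0 hatt
  -- UPPER
  obtain ⟨C₁, C₂, c, hC₁, hC₂, hc', hlift⟩ := Summit.QuantumFields.YangMills.Theorems.SmoothLift.stub_smoothLift L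
  obtain ⟨e₂, he₂, hU⟩ := upperAlongRegPrMinimisersAt_of_splitLog' ha₀ ha₁ hB₃0 hB₄ hC₁ hC₂ hc' hIn8 hgrad hlift
  -- LOWER
  obtain ⟨D₁, D₂, d, hD₁, hD₂, hd, havg⟩ := Summit.QuantumFields.YangMills.Theorems.AvgCurvGrad.stub_avgCurvGrad L
  obtain ⟨E₂, e, hE₂, he, hdef⟩ := Summit.QuantumFields.YangMills.Theorems.AvgActionDefect.stub_avgActionDefect L
  obtain ⟨e₃, he₃, hLo⟩ := lowerAlongRegPrMinimisersAt_of_splitLog''' hL.le ha₀ ha₁ hB₃0 hB₄ hD₂ hd hE₂ he hIn8 hgrad havg hdef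
  -- the common `ε₁`, `m₀ = 10`, `γ₁`
  refine ⟨min e₁ (min e₂ e₃), lt_min he₁ (lt_min he₂ he₃), fun ε₀ hε hεle => ⟨10, fun m hm b₀ p₀ hb hp => ?_⟩⟩
  have hε₁ : ε₀ ≤ e₁ := hεle.trans (min_le_left _ _)
  have hε₂ : ε₀ ≤ e₂ := hεle.trans ((min_le_right _ _).trans (min_le_left _ _))
  have hε₃ : ε₀ ≤ e₃ := hεle.trans ((min_le_right _ _).trans (min_le_right _ _))
  have hm2 : 2 ≤ m := le_trans (by norm_num) hm
  have hp0 : 0 < p₀ := lt_trans two_pos hp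
  obtain ⟨γa, hγa, hA⟩ := hE ε₀ hε hε₁ m hm2 b₀ p₀ hb
  obtain ⟨γb, hγb, hB⟩ := hU ε₀ hε hε₂ m hm b₀ p₀ hb hp0
  obtain ⟨γc, hγc, hC⟩ := hLo ε₀ hε hε₃ m hm b₀ p₀ hb hp0
  refine ⟨min γa (min γb γc), lt_min hγa (lt_min hγb hγc), fun F γ hFL hγ hγle => ?_⟩
  have hγa' : γ ≤ γa := hγle.trans (min_le_left _ _)
  have hγb' : γ ≤ γb := hγle.trans ((min_le_right _ _).trans (min_le_left _ _))
  have hγc' : γ ≤ γc := hγle.trans ((min_le_right _ _).trans (min_le_right _ _))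
  exact minimiserStabilityRegPrAt_of_alongRegPrMinimisers hγ.le (hA F γ hFL hγ hγa') (hB F γ hFL hγ hγb') (hC F γ hFL hγ hγc')

/-! ## §3 The crux BY NAME is equivalent to its L = 3 instance -/

/-- ★★★ **`MinimiserStabilityRegPr` ⟸ ⟨its own body at L = 3⟩, NOTHING ELSE**: at `L ≥ 5` the body is ✓`minimiserStabilityRegPr_guarded_five L` (no hypothesis),
off the admissible block sizes it is vacuous (§1).  CONDITIONAL on `h3`; credits nothing. [cite: Balaban1985Variational, Thm 1 (6)-(10) pp.278-279, Prop. 7 p.299; Balaban1987RG1, §0 p.251] -/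
theorem minimiserStabilityRegPr_of_three
    (h3 : ∃ ε₁ : ℝ, 0 < ε₁ ∧ ∀ (ε₀ : ℝ), 0 < ε₀ → ε₀ ≤ ε₁ → ∃ m₀ : ℕ, ∀ (m : ℕ), m₀ ≤ m →
      ∀ (b₀ p₀ : ℝ), 0 < b₀ → 2 < p₀ → ∃ γ₁ : ℝ, 0 < γ₁ ∧ ∀ (F : T3Family) (γ : ℝ), F.L = 3 → 0 < γ → γ ≤ γ₁ →
        MinimiserStabilityRegPrAt F γ b₀ p₀ m ε₀) :
    Summit.QuantumFields.YangMills.Theses.UnitScaleTilt.MinimiserStabilityRegPr := by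
  intro L
  rcases blockSize_trichotomy L with h | rfl | h5
  · exact cruxBody_of_not_admissible L h
  · exact h3
  · exact minimiserStabilityRegPr_guarded_five L h5

/-- ★★★ **THE REGISTERED CRUX IS EQUIVALENT TO ITS L = 3 INSTANCE**: `MinimiserStabilityRegPr ↔ ⟨body at L = 3⟩` — a post-freeze re-cut `5 ≤ L →` removes exactly
this conjunct and nothing else; an L = 3 supplier must deliver exactly it. An EQUIVALENCE, not a closure. [cite: Balaban1985Variational, Thm 1 (6)-(10) pp.278-279, Prop. 7 p.299; Balaban1987RG1, §0 p.251] -/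
theorem minimiserStabilityRegPr_iff_three :
    Summit.QuantumFields.YangMills.Theses.UnitScaleTilt.MinimiserStabilityRegPr ↔
      ∃ ε₁ : ℝ, 0 < ε₁ ∧ ∀ (ε₀ : ℝ), 0 < ε₀ → ε₀ ≤ ε₁ → ∃ m₀ : ℕ, ∀ (m : ℕ), m₀ ≤ m →
        ∀ (b₀ p₀ : ℝ), 0 < b₀ → 2 < p₀ → ∃ γ₁ : ℝ, 0 < γ₁ ∧ ∀ (F : T3Family) (γ : ℝ), F.L = 3 → 0 < γ → γ ≤ γ₁ →
          MinimiserStabilityRegPrAt F γ b₀ p₀ m ε₀ :=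
  ⟨fun h => h 3, minimiserStabilityRegPr_of_three⟩

/-! ## §4 The crux BY NAME from the EX body at L = 3 alone -/

/-- ★★★ **`MinimiserStabilityRegPr` BY NAME ⟸ ⟨EX body at L = 3⟩ ALONE** (§2 at `L = 3` ∘ §3): what an L = 3 supplier of [Balaban1985Variational] Prop. 7's existence clause
(equivalently, by ✓`minimiserStabilityRegPr_of_thm2SS55`, of [Balaban1985RegularSpaces] Thm 2 at L = 3) buys.  CONDITIONAL; credits nothing.
[cite: Balaban1985Variational, Thm 1 (6)-(10) pp.278-279, Prop. 7 p.299, Prop. 8 p.304] -/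
theorem minimiserStabilityRegPr_of_exBody_three
    (hEX3 : ∀ (B₃ : ℝ), 4 < B₃ → ∃ a₁' O₁ : ℝ, 0 < a₁' ∧ 1 ≤ O₁ ∧
      ∀ (F : T3Family), F.L = 3 → ∀ (n K : ℕ) (hnK : n < K) (ε₁ : ℝ), 0 < ε₁ →
        ∀ V : GaugeField (F.P n) 0 (Matrix.specialUnitaryGroup (Fin 2) ℂ), PlaqSmall ε₁ V →
          ∀ U₀ : GaugeField (F.P K) 0 (Matrix.specialUnitaryGroup (Fin 2) ℂ), RegPr F n K (((3 : ℕ) : ℝ) ^ 3 * B₃ * ε₁) U₀ → U₀ ∈ fibre F ℰp n K hnK.le V →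
            ε₁ ≤ a₁' → ∃ U ∈ regFibrePr F n K hnK.le (O₁ * ((3 : ℕ) : ℝ) ^ 3 * B₃ * ε₁) V,
              IsMinOn (fun W : GaugeField (F.P K) 0 (Matrix.specialUnitaryGroup (Fin 2) ℂ) => wilsonAction4 W)
                (regFibrePr F n K hnK.le (O₁ * ((3 : ℕ) : ℝ) ^ 3 * B₃ * ε₁) V) U) :
    Summit.QuantumFields.YangMills.Theses.UnitScaleTilt.MinimiserStabilityRegPr :=
  minimiserStabilityRegPr_of_three (cruxBody_of_exBody 3 (by norm_num) hEX3)

end Summit.QuantumFields.YangMills.Theorems.MinimiserStabilityRegPrResidueThree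

end
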